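import Summits.KontsevichZagierPeriods.Zeta5Search.Barrier.ConeGammaOneFormSound

/-!
# ζ(5) search — BARRIER: `γ` AS ONE AFFINE FORM ON A BOX with the `C₀` piece as a hull form (checker + soundness)

HONEST FRAMING (cell `pub-zeta5`): systematic search; no irrationality claim unless kernel-certified. Kernel ARITHMETIC about
the MODEL functionals `C₁`, `C₀`, `δ₂₈`, `Φ = phi30` and the MODEL rate `γ = gamma` of `ConeGammaRates` under Brown–Zudilin's
(28)+(30) ((28) observed, not proved) on a direction BOX (cert-2 g36's boxes). Every `γ`-bound obtained this way is an UPPER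
bound over its box, ABOVE the centre's pinned value; NOTHING here is about the cone's supremum (C2 = `BarrierC2`, OPEN), S-E
(CONJECTURED), (TD_A) or `ζ(5)`; no number of record moves; records in print UNMOVED. Theory seat cert-2 g40 (item «C₀ TO
FIRST ORDER IN THE FAR CHART — THE CENTRE-SLICE CERTIFICATE», part 4): cert-2 g39's one-form (`ConeGammaOneForm*`) with the
constant `c₀⁻` replaced by the centre-slice LOWER FORM `s₀·(C₀⁰ + Σ_i (t_i − t_{c,i})·u_i) ≤ C₀(a)`, `u` in a hull `U`
(`ConeGammaFarSliceCert.C0_lower_hull`).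

THE ARITHMETIC. `(1 − γ*)·C₁ − C₀ − γ*·δ₂₈ + γ*·Φ ≤ 0` on the box `⇒ γ ≤ γ*` (g39's `frac_le_of_oneForm`), with `C₁ ≤ s₀c₁⁺/den`
(g38, by name), `δ₂₈ ≥` the mixture of five-set sums (g39's `delta28_ge_mixture`), `Φ ≤ s₀(I.hi/SC + Σ (t_i − t_{c,i}) v_i)`
(g36/g39's `phi30_le_hull`) and the `C₀` hull form. Per coordinate the slope `γ*(v_i − d_i/W) − u_i` is affine in
`(v_i, u_i) ∈ g_i × U_i`, so its modulus is bounded by the largest corner value (`slopeMag2`, exact integers); the box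
supremum is `base + Σ r_i·slopeMag2_i` (`oneFormCheck2`, none Prop-valued); **`gamma_le_of_oneFormCheck2`** is the theorem.
-/

open Finset Set MeasureTheory
open Literature.Analysis.ValidatedNumerics.NumericsMP

namespace Summit.KontsevichZagierPeriods.Zeta5Search.Barrier.ConeGamma

namespace FarSlice

open LemmaFBox (SC KT lnNat SC_pos coef featVal minNum maxNum sum8 box centre centre_mem abs_sub_centre_le abs_le_of_mem
  getD_map_range featVal_sub_eq_sum sum8_eq_sum aOfS_normalise box_hyp)
open LemmaFWin (cutsOK)
open LemmaFWinBox
open OneForm (mixVec dsetOK cenNum wboxHullN delta28_ge_mixture phi30_le_hull frac_le_of_oneForm featVal_centre_expand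
  featVal_centre_eq)

/-! ### The checker -/

/-- One corner of the scaled slope `gnum·(v′·W − d·SC) − gden·W·u′`. -/
def slopeCorner (gnum gden W : ℕ) (d v' u' : ℤ) : ℤ := (gnum : ℤ) * (v' * W - d * (SC : ℤ)) - (gden : ℤ) * W * u'

/-- Per-coordinate slope magnitude bound at scale `gden·W·SC`: the largest modulus of the scaled slope
`gnum·(v′_i W − d_i SC) − gden·W·u′_i` over the four corners `v′_i ∈ {g_i.lo, g_i.hi}`, `u′_i ∈ {U_i.lo, U_i.hi}`. -/
def slopeMag2 (g U : List MI) (d : List ℤ) (W gnum gden : ℕ) (i : ℕ) : ℤ :=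
  max (max |slopeCorner gnum gden W (coef d i) (getI g i).lo (getI U i).lo|
        |slopeCorner gnum gden W (coef d i) (getI g i).lo (getI U i).hi|)
    (max |slopeCorner gnum gden W (coef d i) (getI g i).hi (getI U i).lo|
        |slopeCorner gnum gden W (coef d i) (getI g i).hi (getI U i).hi|)

/-- The scaled slack `Σ_i (hi_i − lo_i)·slopeMag2_i` (scale `2D·gden·W·SC`). -/
def slackNum2 (g U : List MI) (d : List ℤ) (W gnum gden : ℕ) (lo hi : List ℕ) : ℤ :=
  sum8 fun i => (((hi.getD i 0 : ℕ) : ℤ) - ((lo.getD i 0 : ℕ) : ℤ)) * slopeMag2 g U d W gnum gden i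

/-- **THE ONE-FORM BOX CHECK with the `C₀` hull form.** Data: the box `(D, lo, hi)`, g36's Φ-data `(E, cuts, mems)`, g39's
δ-mixture `Ss`, `c₁⁺ = c1hi/den`, the `C₀` form (`C₀⁰ = c0num/c0den`, hull `U` at scale `SC`), and `γ* = gnum/gden ∈ [0, 1]`.
It decides, in exact integers, `L·[(1 − γ*)c₁⁺ − C₀⁰ − γ*·mix(t_c) + γ*·I.hi/SC] + slack ≤ 0` with
`L = den·c0den·2D·W·SC·gden`. -/
def oneFormCheck2 (lo hi : List ℕ) (D E : ℕ) (cuts : List ℕ) (mems : List (Fin 7 × Fin 7)) (Ss : List (List (Fin 28)))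
    (c1hi : ℤ) (den : ℕ) (c0num : ℤ) (c0den : ℕ) (U : List MI) (gnum gden : ℕ) : Bool :=
  boxOK8 D lo hi && cutsOK E cuts mems && wallOKBox lo hi E (cuts.getD 0 0) D && decide (0 < den) && decide (0 < c0den) &&
    decide (0 < gden) && decide (gnum ≤ gden) && decide (0 < Ss.length) && (Ss.all fun S => dsetOK S) &&
    match wboxHullN lo hi D E cuts mems with
    | some (I, g) =>
      let W : ℤ := Ss.length
      decide (((gden : ℤ) - gnum) * c1hi * c0den * (2 * D) * W * (SC : ℤ)
          - (gden : ℤ) * c0num * den * (2 * D) * W * (SC : ℤ)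
          - (gnum : ℤ) * cenNum (mixVec Ss) lo hi * den * c0den * (SC : ℤ)
          + (gnum : ℤ) * I.hi * den * c0den * (2 * D) * W
          + slackNum2 g U (mixVec Ss) Ss.length gnum gden lo hi * den * c0den ≤ 0)
    | none => false

/-! ### Soundness -/

/-- The modulus of an affine function of two variables on a rectangle is bounded by its largest corner modulus. -/
theorem abs_affine2_le {α β γ x y a b c d : ℝ} (hx1 : a ≤ x) (hx2 : x ≤ b) (hy1 : c ≤ y) (hy2 : y ≤ d) :
    |α * x + β * y + γ| ≤ max (max |α * a + β * c + γ| |α * a + β * d + γ|) (max |α * b + β * c + γ| |α * b + β * d + γ|) := by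
  -- in `x` for fixed `y`, then in `y`
  have step : ∀ {u v w lo' hi' : ℝ}, lo' ≤ w → w ≤ hi' →
      |u * w + v| ≤ max |u * lo' + v| |u * hi' + v| := by
    intro u v w lo' hi' h1 h2
    rcases le_or_gt 0 u with hu | hu
    · exact abs_le_max_abs_abs (by nlinarith) (by nlinarith)
    · rw [max_comm]
      exact abs_le_max_abs_abs (by nlinarith) (by nlinarith)
  have hx := step (u := α) (v := β * y + γ) hx1 hx2
  have e1 : α * x + β * y + γ = α * x + (β * y + γ) := by ring
  rw [e1]
  refine hx.trans ?_
  have hya := step (u := β) (v := α * a + γ) hy1 hy2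
  have hyb := step (u := β) (v := α * b + γ) hy1 hy2
  have ea : α * a + (β * y + γ) = β * y + (α * a + γ) := by ring
  have eb : α * b + (β * y + γ) = β * y + (α * b + γ) := by ring
  rw [ea, eb]
  refine max_le_max (hya.trans (le_of_eq ?_)) (hyb.trans (le_of_eq ?_)) <;> congr 1 <;> (try congr 1) <;> ring_nf

/-- One coordinate of the slope: `|γ*·(v_i − d_i/W) − u_i| ≤ slopeMag2_i/(gden·W·SC)` for `v_i ∈ g_i`, `u_i ∈ U_i`. -/
theorem slope2_abs_le {g U : List MI} {d : List ℤ} {W gnum gden : ℕ} (hW : 0 < W) (hgden : 0 < gden) {v u : ℝ} {i : Fin 8}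
    (hv : MI.mem SC v (getI g i)) (hu : MI.mem SC u (getI U i)) :
    |(gnum : ℝ) / gden * (v - (coef d i : ℝ) / W) - u| ≤ (slopeMag2 g U d W gnum gden i : ℝ) / ((gden : ℝ) * W * SC) := by
  have hS : (0 : ℝ) < SC := by exact_mod_cast SC_pos
  have hW' : (0 : ℝ) < W := by exact_mod_cast hW
  have hg' : (0 : ℝ) < gden := by exact_mod_cast hgden
  rw [le_div_iff₀ (by positivity)]
  have e : |(gnum : ℝ) / gden * (v - (coef d i : ℝ) / W) - u| * ((gden : ℝ) * W * SC)
      = |((gnum : ℝ) * W) * (v * SC) + (-(gden : ℝ) * W) * (u * SC) + (-(gnum : ℝ) * (coef d i) * SC)| := by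
    rw [← abs_of_pos (by positivity : (0 : ℝ) < (gden : ℝ) * W * SC), ← abs_mul]
    congr 1; field_simp; ring
  rw [e]
  obtain ⟨h1, h2⟩ := hv
  obtain ⟨h3, h4⟩ := hu
  refine (abs_affine2_le h1 h2 h3 h4).trans (le_of_eq ?_)
  unfold slopeMag2 slopeCorner
  push_cast
  have e : ∀ v' u' : ℤ, (gnum : ℝ) * W * (v' : ℝ) + -(gden : ℝ) * W * (u' : ℝ) + -(gnum : ℝ) * (coef d i) * SC
      = (gnum : ℝ) * ((v' : ℝ) * W - (coef d i : ℝ) * SC) - (gden : ℝ) * W * u' := fun v' u' => by ring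
  rw [e, e, e, e]

/-- **SOUNDNESS OF THE ONE-FORM CHECK WITH THE `C₀` HULL FORM.** If `oneFormCheck2 … = true` then for EVERY direction `a` of the
closed box whose normalised parameters lie in the box, `C₁(a) ≤ s₀·c₁⁺/den`, the centre-slice form
`s₀·(C₀⁰ + Σ (t_i − t_{c,i})u_i) ≤ C₀(a)` for some `u ∈ U`, and `C₀(a) ≤ C₁(a)` imply `γ(a) ≤ gnum/gden`.
(MODEL `gamma` under (28)+(30); an upper bound over the box; nothing about the cone's supremum.) -/
theorem gamma_le_of_oneFormCheck2 {lo hi : List ℕ} {D E : ℕ} {cuts : List ℕ} {mems : List (Fin 7 × Fin 7)}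
    {Ss : List (List (Fin 28))} {c1hi : ℤ} {den : ℕ} {c0num : ℤ} {c0den : ℕ} {U : List MI} {gnum gden : ℕ}
    (hc : oneFormCheck2 lo hi D E cuts mems Ss c1hi den c0num c0den U gnum gden = true) {a : Dir} (ha : BZBox a)
    (h : ∀ j : Fin 7, ((lo.getD j.succ 0 : ℕ) : ℝ) ≤ sParam a j.succ / sParam a 0 * D ∧
      sParam a j.succ / sParam a 0 * D ≤ ((hi.getD j.succ 0 : ℕ) : ℝ))
    (hC1 : C1 a ≤ sParam a 0 * ((c1hi : ℝ) / den))
    (hC0 : ∃ u : Fin 8 → ℝ, (∀ i : Fin 8, MI.mem SC (u i) (getI U i)) ∧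
      sParam a 0 * ((c0num : ℝ) / c0den + ∑ i : Fin 8, (sParam a i / sParam a 0 - centre D lo hi i) * u i) ≤ C0 a)
    (hord : C0 a ≤ C1 a) : gamma a ≤ (gnum : ℝ) / gden := by
  unfold oneFormCheck2 at hc
  simp only [Bool.and_eq_true, decide_eq_true_eq, List.all_eq_true] at hc
  obtain ⟨⟨⟨⟨⟨⟨⟨⟨⟨hbox, hcuts⟩, hwall⟩, hden⟩, hc0den⟩, hgden⟩, hgle⟩, hW⟩, hSs⟩, hineq⟩ := hc
  split at hineq
  swap
  · simp at hineq
  rename_i I g hh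
  rw [decide_eq_true_eq] at hineq
  obtain ⟨hD, hlo0, hhi0, hle⟩ := boxOK8_spec hbox
  have ht := box_hyp ha ⟨hlo0, hhi0⟩ h
  have hD' : (0 : ℝ) < D := by exact_mod_cast hD
  have hS : (0 : ℝ) < SC := by exact_mod_cast SC_pos
  have hden' : (0 : ℝ) < den := by exact_mod_cast hden
  have hc0den' : (0 : ℝ) < c0den := by exact_mod_cast hc0den
  have hgden' : (0 : ℝ) < gden := by exact_mod_cast hgden
  have hWr : (0 : ℝ) < Ss.length := by exact_mod_cast hW
  have hs0 : 0 < sParam a 0 := ha.1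
  set t : Fin 8 → ℝ := fun i => sParam a i / sParam a 0 with htdef
  set tc := centre D lo hi with htc
  set γs : ℝ := (gnum : ℝ) / gden with hγ
  have hγ0 : 0 ≤ γs := by positivity
  have hγ1 : γs ≤ 1 := by rw [hγ, div_le_one hgden']; exact_mod_cast hgle
  have hSs' : ∀ S ∈ Ss, dsetOK S = true := hSs
  -- Φ
  obtain ⟨v, hv, hΦ⟩ := phi30_le_hull hbox hcuts hwall hh ha ht
  -- δ
  have htmem : t ∈ box D lo hi := ht
  have hn := aOfS_normalise ha
  have hδ : sParam a 0 * (featVal (mixVec Ss) t / Ss.length) ≤ delta28 a := by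
    have e : delta28 a = sParam a 0 * delta28 (aOfS t) := by
      conv_lhs => rw [hn]
      rw [delta28_smul hs0.le]
    rw [e]
    exact mul_le_mul_of_nonneg_left (delta28_ge_mixture hSs' hW t) hs0.le
  -- C₀
  obtain ⟨u, hu, hC0u⟩ := hC0
  set d := mixVec Ss with hd
  have hexp := featVal_centre_expand d t tc
  have hcen := featVal_centre_eq hD d lo hi
  -- slope bound per coordinate
  have hterm : ∀ i : Fin 8, (t i - tc i) * (γs * (v i - (coef d i : ℝ) / Ss.length) - u i) ≤
      (((hi.getD i 0 : ℕ) : ℝ) - ((lo.getD i 0 : ℕ) : ℝ)) / (2 * D) *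
        ((slopeMag2 g U d Ss.length gnum gden i : ℝ) / ((gden : ℝ) * Ss.length * SC)) := by
    intro i
    refine (le_abs_self _).trans ?_
    rw [abs_mul]
    refine mul_le_mul (abs_sub_centre_le hD htmem i) (slope2_abs_le hW hgden (hv i) (hu i)) (abs_nonneg _) ?_
    have : ((lo.getD i 0 : ℕ) : ℝ) ≤ ((hi.getD i 0 : ℕ) : ℝ) := by exact_mod_cast (hle i).1
    exact div_nonneg (by linarith) (by positivity)
  have hslack : ∑ i : Fin 8, (t i - tc i) * (γs * (v i - (coef d i : ℝ) / Ss.length) - u i) ≤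
      (slackNum2 g U d Ss.length gnum gden lo hi : ℝ) / (2 * D * ((gden : ℝ) * Ss.length * SC)) := by
    refine (Finset.sum_le_sum fun i _ => hterm i).trans (le_of_eq ?_)
    unfold slackNum2
    rw [sum8_eq_sum]; push_cast
    rw [Finset.sum_div]
    refine Finset.sum_congr rfl fun i _ => ?_
    field_simp
  -- the integer inequality as a per-unit-s₀ statement
  have hI : ((((gden : ℤ) - gnum) * c1hi * c0den * (2 * D) * (Ss.length : ℤ) * (SC : ℤ)
      - (gden : ℤ) * c0num * den * (2 * D) * (Ss.length : ℤ) * (SC : ℤ)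
      - (gnum : ℤ) * cenNum d lo hi * den * c0den * (SC : ℤ)
      + (gnum : ℤ) * I.hi * den * c0den * (2 * D) * (Ss.length : ℤ)
      + slackNum2 g U d Ss.length gnum gden lo hi * den * c0den : ℤ) : ℝ) ≤ 0 := by
    rw [hd]; exact_mod_cast hineq
  push_cast at hI
  have hform : (1 - γs) * ((c1hi : ℝ) / den) - (c0num : ℝ) / c0den - γs * (featVal d tc / Ss.length)
      + γs * ((I.hi : ℝ) / SC) + (slackNum2 g U d Ss.length gnum gden lo hi : ℝ) / (2 * D * ((gden : ℝ) * Ss.length * SC)) ≤ 0 := by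
    have hpos : (0 : ℝ) < (den : ℝ) * c0den * (2 * D) * Ss.length * SC * gden := by positivity
    have e1 : featVal d tc = (cenNum d lo hi : ℝ) / (2 * D) := by
      rw [← hcen, htc]; field_simp
    rw [e1, hγ]
    have h := div_nonpos_of_nonpos_of_nonneg hI hpos.le
    refine le_trans (le_of_eq ?_) h
    field_simp
  -- assemble `E(a) ≤ s₀·(form at t) ≤ 0`
  have hE : (1 - γs) * C1 a - C0 a - γs * delta28 a + γs * phi30 a ≤ 0 := by
    have h1 : (1 - γs) * C1 a ≤ (1 - γs) * (sParam a 0 * ((c1hi : ℝ) / den)) :=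
      mul_le_mul_of_nonneg_left hC1 (by linarith)
    have h3 : γs * delta28 a ≥ γs * (sParam a 0 * (featVal d t / Ss.length)) := mul_le_mul_of_nonneg_left hδ hγ0
    have h4 : γs * phi30 a ≤ γs * (sParam a 0 * ((I.hi : ℝ) / SC + ∑ i : Fin 8, (t i - tc i) * v i)) :=
      mul_le_mul_of_nonneg_left hΦ hγ0
    -- the three `t`-dependent sums combine into the slope sum
    have hsum : γs * (∑ i : Fin 8, (t i - tc i) * v i) - γs * ((∑ i : Fin 8, (t i - tc i) * (coef d i : ℝ)) / Ss.length)
        - ∑ i : Fin 8, (t i - tc i) * u i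
        = ∑ i : Fin 8, (t i - tc i) * (γs * (v i - (coef d i : ℝ) / Ss.length) - u i) := by
      rw [Finset.mul_sum, Finset.sum_div, Finset.mul_sum, ← Finset.sum_sub_distrib, ← Finset.sum_sub_distrib]
      exact Finset.sum_congr rfl fun i _ => by ring
    have key : (1 - γs) * (sParam a 0 * ((c1hi : ℝ) / den))
        - sParam a 0 * ((c0num : ℝ) / c0den + ∑ i : Fin 8, (t i - tc i) * u i)
        - γs * (sParam a 0 * (featVal d t / Ss.length))
        + γs * (sParam a 0 * ((I.hi : ℝ) / SC + ∑ i : Fin 8, (t i - tc i) * v i)) ≤ 0 := by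
      rw [hexp]
      have e : (1 - γs) * (sParam a 0 * ((c1hi : ℝ) / den))
          - sParam a 0 * ((c0num : ℝ) / c0den + ∑ i : Fin 8, (t i - tc i) * u i)
          - γs * (sParam a 0 * ((featVal d tc + ∑ i : Fin 8, (t i - tc i) * (coef d i : ℝ)) / Ss.length))
          + γs * (sParam a 0 * ((I.hi : ℝ) / SC + ∑ i : Fin 8, (t i - tc i) * v i))
          = sParam a 0 * ((1 - γs) * ((c1hi : ℝ) / den) - (c0num : ℝ) / c0den - γs * (featVal d tc / Ss.length)
            + γs * ((I.hi : ℝ) / SC)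
            + (γs * (∑ i : Fin 8, (t i - tc i) * v i) - γs * ((∑ i : Fin 8, (t i - tc i) * (coef d i : ℝ)) / Ss.length)
              - ∑ i : Fin 8, (t i - tc i) * u i)) := by
        rw [add_div]; ring
      rw [e, hsum]
      exact mul_nonpos_of_nonneg_of_nonpos hs0.le (by linarith)
    linarith
  unfold gamma
  exact frac_le_of_oneForm hord hγ0 hE

end FarSlice

end Summit.KontsevichZagierPeriods.Zeta5Search.Barrier.ConeGamma
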